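import Summits.Schanuel.Schanuel.Theorems.ZilberEacRealSplitParam
import HarnessLib

/-!
# Coordinate permutations preserve Zariski density of exponential points; the (3,2) split family with either slope irrational

Zilber's Exponential-Algebraic Closedness, case ladder (host summit Schanuel, cell `pub-schanuel`,
seat 2, gen 7).

* `unprojectedDense_compPerm_iff` — for a permutation `e` of `Fin n` acting simultaneously on the
  additive and multiplicative coordinates, `W' = {z : z ∘ (e ⊕ e) ∈ W}` has Zariski dense exponential
  points iff `W` does (`I(·)` transforms by `MvPolynomial.rename`; `Γ_exp` is invariant).
* `unprojectedDense_realSplitParam_two'` — the `(3,2)` density theorem of `ZilberEacRealSplitParam`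
  with the OTHER slope irrational: `r₀ ∉ ℚ` (e.g. the PERIODIC-piece member
  `x₂ = √2 x₀ + x₁ + c` × parametrised curve), by the swap `0 ↔ 1`.

**HONEST FRAMING.** Explicit families; nothing here bears on Schanuel's conjecture; `ECCell 3 2` OPEN.
-/

noncomputable section

open MvPolynomial Filter Topology Complex Metric
open Literature.NumberTheory.Transcendental Literature.ModelTheory.Zilber
  Literature.ModelTheory.ExponentialFields

set_option linter.dupNamespace false

namespace Summit.Schanuel.Schanuel.Theorems

section Perm

variable {n : ℕ}

/-- Membership in the vanishing ideal of a coordinate-permuted set: `F ∈ I({z | z ∘ ee ∈ S})` iff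
`rename ee⁻¹ F ∈ I(S)`. -/
theorem mem_vanishingIdeal_compPerm_iff (ee : (Fin n ⊕ Fin n) ≃ (Fin n ⊕ Fin n))
    (S : Set (Fin n ⊕ Fin n → ℂ)) (F : MvPolynomial (Fin n ⊕ Fin n) ℂ) :
    F ∈ vanishingIdeal ℂ {z : Fin n ⊕ Fin n → ℂ | z ∘ ee ∈ S} ↔
      MvPolynomial.rename ee.symm F ∈ vanishingIdeal ℂ S := by
  constructor
  · intro h
    refine mem_vanishingIdeal_of_eval fun w hw => ?_
    rw [MvPolynomial.eval_rename]
    refine eval_eq_zero_of_mem_vanishingIdeal h ?_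
    show (w ∘ ee.symm) ∘ ee ∈ S
    rw [Function.comp_assoc, Equiv.symm_comp_self, Function.comp_id]
    exact hw
  · intro h
    refine mem_vanishingIdeal_of_eval fun z hz => ?_
    have h1 := eval_eq_zero_of_mem_vanishingIdeal h hz
    rw [MvPolynomial.eval_rename, Function.comp_assoc, Equiv.self_comp_symm,
      Function.comp_id] at h1
    exact h1

/-- The graph of `exp` is invariant under simultaneous permutation of the coordinates. -/
theorem comp_sumMap_mem_expGraph_iff (e : Equiv.Perm (Fin n)) (z : Fin n ⊕ Fin n → ℂ) :
    z ∘ (Equiv.sumCongr e e) ∈ expGraph ℂ n ↔ z ∈ expGraph ℂ n := by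
  simp only [mem_expGraph_iff, Function.comp_apply, Equiv.sumCongr_apply, Sum.map_inr,
    Sum.map_inl]
  constructor
  · intro h i
    have := h (e.symm i)
    simpa using this
  · intro h i
    exact h (e i)

/-- **Zariski density of exponential points is invariant under coordinate permutations**
(simultaneous on both factors). -/
theorem unprojectedDense_compPerm_iff (e : Equiv.Perm (Fin n)) (W : Set (Fin n ⊕ Fin n → ℂ)) :
    UnprojectedDense {z : Fin n ⊕ Fin n → ℂ | z ∘ (Equiv.sumCongr e e) ∈ W} ↔
      UnprojectedDense W := by
  set ee : (Fin n ⊕ Fin n) ≃ (Fin n ⊕ Fin n) := Equiv.sumCongr e e with hee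
  have hinter : {z : Fin n ⊕ Fin n → ℂ | z ∘ ee ∈ W} ∩ expGraph ℂ n =
      {z : Fin n ⊕ Fin n → ℂ | z ∘ ee ∈ W ∩ expGraph ℂ n} := by
    ext z
    simp only [Set.mem_inter_iff, Set.mem_setOf_eq, hee, comp_sumMap_mem_expGraph_iff]
  constructor
  · intro h
    refine le_antisymm ?_ (vanishingIdeal_anti_mono Set.inter_subset_left)
    intro F hF
    -- transport `rename ee F` through the permuted set
    have h1 : MvPolynomial.rename ee F ∈ vanishingIdeal ℂ
        ({z : Fin n ⊕ Fin n → ℂ | z ∘ ee ∈ W} ∩ expGraph ℂ n) := by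
      rw [hinter, mem_vanishingIdeal_compPerm_iff, MvPolynomial.rename_rename,
        Equiv.symm_comp_self, MvPolynomial.rename_id]
      exact hF
    rw [h, mem_vanishingIdeal_compPerm_iff, MvPolynomial.rename_rename, Equiv.symm_comp_self,
      MvPolynomial.rename_id] at h1
    exact h1
  · intro h
    refine le_antisymm ?_ (vanishingIdeal_anti_mono Set.inter_subset_left)
    intro F hF
    rw [hinter, mem_vanishingIdeal_compPerm_iff, h] at hF
    rwa [mem_vanishingIdeal_compPerm_iff]

end Perm

section Swap

/-- **(3,2) density with the other slope irrational.** `r₀ ∉ ℚ`, `q₀, q₁, p₀ ≠ 0`,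
`deg p₀ ≠ r₀ deg q₀ + r₁ deg q₁` ⟹ the exponential points of
`W = {(x₀, x₁, r₀x₀ + r₁x₁ + c ; q₀(t), q₁(t), p₀(t))}` are Zariski dense in `W` (apply
`unprojectedDense_realSplitParam_two` to the swapped data and permute back). -/
theorem unprojectedDense_realSplitParam_two' (r : Fin 2 → ℝ) (hr : Irrational (r 0)) (c : ℂ)
    {q : Fin 2 → Polynomial ℂ} (hq : ∀ j, q j ≠ 0) {p₀ : Polynomial ℂ} (hp₀ : p₀ ≠ 0)
    (hdeg : (p₀.natDegree : ℝ) ≠ ∑ j, r j * ((q j).natDegree : ℝ)) :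
    UnprojectedDense {z : Fin 3 ⊕ Fin 3 → ℂ | ∃ a b t : ℂ,
      z = Sum.elim ![a, b, (r 0 : ℂ) * a + (r 1 : ℂ) * b + c]
        ![(q 0).eval t, (q 1).eval t, p₀.eval t]} := by
  -- the swapped data
  set r' : Fin 2 → ℝ := ![r 1, r 0] with hr'
  set q' : Fin 2 → Polynomial ℂ := ![q 1, q 0] with hq'
  have hq'0 : ∀ j, q' j ≠ 0 := fun j => by fin_cases j <;> simp [hq', hq]
  have hdeg' : (p₀.natDegree : ℝ) ≠ ∑ j, r' j * ((q' j).natDegree : ℝ) := by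
    rw [Fin.sum_univ_two] at hdeg ⊢
    simp only [hr', hq', Matrix.cons_val_zero, Matrix.cons_val_one]
    intro h
    apply hdeg
    linarith
  have hdense := unprojectedDense_realSplitParam_two r' (by simpa [hr'] using hr) c hq'0 hp₀ hdeg'
  -- the swap `0 ↔ 1` on `Fin 3`
  set e : Equiv.Perm (Fin 3) := Equiv.swap 0 1 with he
  rw [← unprojectedDense_compPerm_iff e] at hdense
  convert hdense using 2
  ext z
  simp only [Set.mem_setOf_eq]
  constructor
  · rintro ⟨a, b, t, rfl⟩
    refine ⟨b, a, t, ?_⟩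
    funext i
    (rcases i with i | i <;> fin_cases i <;>
      simp [he, hr', hq', Equiv.swap_apply_of_ne_of_ne])
    ring
  · rintro ⟨a, b, t, hz⟩
    refine ⟨b, a, t, ?_⟩
    have h0 := congrFun hz (Sum.inl 0)
    have h1 := congrFun hz (Sum.inl 1)
    have h2 := congrFun hz (Sum.inl 2)
    have h3 := congrFun hz (Sum.inr 0)
    have h4 := congrFun hz (Sum.inr 1)
    have h5 := congrFun hz (Sum.inr 2)
    simp [he, hr', hq', Equiv.swap_apply_of_ne_of_ne] at h0 h1 h2 h3 h4 h5
    funext i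
    (rcases i with i | i <;> fin_cases i <;> simp [h0, h1, h2, h3, h4, h5])
    ring

end Swap

end Summit.Schanuel.Schanuel.Theorems

end
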